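import Summits.AtomisticToContinuum.HydrodynamicLimit.Theorems.JParityClosureParityBandClosureStressIsotropyOfWindowCovarianceA
import Summits.AtomisticToContinuum.HydrodynamicLimit.Theorems.JParityClosureParityBandClosureStressIsotropyOfWindowCovarianceC
import Summits.AtomisticToContinuum.HydrodynamicLimit.Theorems.JParityClosureParityBandClosureStressIsotropyOfWindowCovarianceE
import Summits.AtomisticToContinuum.HydrodynamicLimit.Theorems.InformationPercolationEngineChaosClosesEulerStressIsotropyD
import HarnessLib

/-!
# Window-to-cone step of `ParityBandClosure` — helper F: the main term of one window

Support file for the stub `stub_stressIsotropyOfWindowCovariance` of the line `transfer-weighted-parity-chain`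
(skeleton v4) of the crux `JParityClosure.ParityBandClosure` (stmt-AtomisticToContinuum-17608).  ONE window `(t₀, x)`
of ONE measurable curve of configurations `γ` with `ke (γ s) ≤ K`, tent `w(s) = bt(s − t₀)` of half-width `r²` fully
inside `[0, τ]`.  §1 the window kit (sup bounds of the cone moments, integrability on `[0, τ]` of every tent-weighted
cone moment); §2 the weight algebra `w (M − mⱼmₖ/ρ) = wM − (wmⱼ)(wmₖ)/(wρ)`, `Σⱼ (wmⱼ − cⱼwρ)²/(wρ) = w ‖m − ρc‖²/ρ`;
§3 `window_main_le` — for a traceless constant test `a` (`|aⱼₖ| ≤ A`) and a constant weight `gw`,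
`|Σ gw aⱼₖ ∫ w Pⱼₖ| ≤ |gw| (A dev + 3A (4V Δm + 4V² Δρ + 6 T̄ + 4 T₀))`: `∫ w Pⱼₖ = C_w − D_w` (helper A), `dev` EXACTLY the
deviator of `WindowCovarianceIsotropy`, `D_w ⪰ 0` with `Σ|D_w| ≤ 3 tr D_w ≤ 3 ∫ w ‖m − ρc‖²/ρ` for the slow centre `c` of the
instant `t₀`, linearised by helper B (`Δm = ∫ w ‖m_r(s) − m_r(t₀)‖`, `Δρ = ∫ w |ρ_r(s) − ρ_r(t₀)|`, `T̄ = ∫ w T`, `T₀ = T(t₀)`,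
`T = MpsiC (sqTail V)`).  Deterministic bookkeeping; no fact of the line is used.
-/

noncomputable section

namespace Summit.AtomisticToContinuum.HydrodynamicLimit.Theorems.ParityBandClosureWindowToCone

open scoped BigOperators Topology Classical MeasureTheory ENNReal InnerProductSpace
open Filter Set MeasureTheory Function
open Literature.MathematicalPhysics.KineticTheory
open Literature.Analysis.FluidPDE
open Literature.Analysis.FunctionSpaces
open Summit.AtomisticToContinuum.HydrodynamicLimit.Theorems.LocalSecondLawNegative
open Summit.AtomisticToContinuum.HydrodynamicLimit.Theorems.LocalSecondLawLedger
open Summit.AtomisticToContinuum.HydrodynamicLimit.Theorems.LocalSecondLawLedger.L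
  (Mmom rhoC_eq_sum momC_apply_eq_sum momC_eq_sum norm_sq_eq_sum)
open Summit.AtomisticToContinuum.HydrodynamicLimit.Theorems.ChaosClosesEulerReduction
open Summit.AtomisticToContinuum.HydrodynamicLimit.Theorems.ChaosClosesEulerStressIsotropy
open Summit.AtomisticToContinuum.HydrodynamicLimit.Theorems.ChaosClosesEulerWindowedInvariance (tent_nonneg_le cone_nonneg_le)
open Summit.AtomisticToContinuum.HydrodynamicLimit.Theorems.ChaosClosesEulerPressureValue (tent_eq_zero_of_le)

variable {N : ℕ}

/-! ## §1 The window kit: sup bounds and integrability along a curve -/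

/-- `|MpsiC ψ| ≤ (3/(πr³)) (N+1)⁻¹ Σ |ψ(vᵢ)|`. [folklore] -/
theorem abs_MpsiC_le_mean {r : ℝ} (hr : 0 < r) (w : Phase N) (x : T3) (ψ : V3 → ℝ) :
    |MpsiC r w x ψ| ≤ 3 / (Real.pi * r ^ 3) * (((N + 1 : ℕ) : ℝ)⁻¹ * ∑ i, |ψ (w i).2|) := by
  rw [MpsiC_eq_sum, abs_mul, abs_of_nonneg (by positivity : (0 : ℝ) ≤ ((N + 1 : ℕ) : ℝ)⁻¹), mul_left_comm, Finset.mul_sum]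
  refine mul_le_mul_of_nonneg_left ((Finset.abs_sum_le_sum_abs _ _).trans (Finset.sum_le_sum fun i _ => ?_))
    (by positivity)
  rw [abs_mul, abs_of_nonneg (cone_nonneg hr _ _)]
  exact mul_le_mul_of_nonneg_right (cone_nonneg_le hr _ _).2 (abs_nonneg _)

/-- The components of the mollified momentum are cone moments: `mⱼ = MpsiC (v ↦ vⱼ)`. [folklore] -/
theorem momC_apply_eq_MpsiC (r : ℝ) (w : Phase N) (x : T3) (j : Fin 3) :
    momC r w x j = MpsiC r w x (fun v => v j) := by
  rw [momC_apply_eq_sum, MpsiC_eq_sum]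

/-- `|MpsiC (v ↦ vⱼ)| ≤ (3/(πr³))(½ + ke)`. [folklore] -/
theorem abs_MpsiC_coord_le {r : ℝ} (hr : 0 < r) (w : Phase N) (x : T3) (j : Fin 3) :
    |MpsiC r w x (fun v => v j)| ≤ 3 / (Real.pi * r ^ 3) * (1 / 2 + ke w) := by
  refine (abs_MpsiC_le_mean hr w x _).trans (mul_le_mul_of_nonneg_left ?_ (by positivity))
  refine le_trans ?_ (meanSpeed_le w)
  refine mul_le_mul_of_nonneg_left (Finset.sum_le_sum fun i _ => ?_) (by positivity)
  simpa using PiLp.norm_apply_le (w i).2 j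

/-- `|MpsiC (v ↦ vⱼvₖ)| ≤ (3/(πr³)) 2ke`. [folklore] -/
theorem abs_MpsiC_quad_le {r : ℝ} (hr : 0 < r) (w : Phase N) (x : T3) (j k : Fin 3) :
    |MpsiC r w x (fun v => v j * v k)| ≤ 3 / (Real.pi * r ^ 3) * (2 * ke w) := by
  refine (abs_MpsiC_le_mean hr w x _).trans (mul_le_mul_of_nonneg_left ?_ (by positivity))
  rw [← mean_norm_sq_eq_two_ke]
  exact mul_le_mul_of_nonneg_left (Finset.sum_le_sum fun i _ => abs_apply_mul_apply_le _ j k) (by positivity)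

/-- `0 ≤ MpsiC (sqTail V) ≤ (3/(πr³)) 2ke`. [folklore] -/
theorem MpsiC_sqTail_le {r : ℝ} (hr : 0 < r) (w : Phase N) (x : T3) (V : ℝ) :
    0 ≤ MpsiC r w x (sqTail V) ∧ MpsiC r w x (sqTail V) ≤ 3 / (Real.pi * r ^ 3) * (2 * ke w) := by
  refine ⟨MpsiC_nonneg hr w x fun v => sqTail_nonneg V v, ?_⟩
  refine (le_abs_self _).trans ((abs_MpsiC_le_mean hr w x _).trans (mul_le_mul_of_nonneg_left ?_ (by positivity)))
  refine le_trans (le_of_eq ?_) (mean_sqTail_le_two_ke V w)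
  congr 1
  exact Finset.sum_congr rfl fun i _ => abs_of_nonneg (sqTail_nonneg V _)

/-- `0 ≤ e_r ≤ (3/(πr³)) ke`. [folklore] -/
theorem kinC_le_sup {r : ℝ} (hr : 0 < r) (w : Phase N) (x : T3) :
    0 ≤ kinC r w x ∧ kinC r w x ≤ 3 / (Real.pi * r ^ 3) * ke w := by
  refine ⟨kinC_nonneg hr w x, ?_⟩
  rw [kinC_eq_sum]
  calc ((N + 1 : ℕ) : ℝ)⁻¹ * ∑ i, cone r (w i).1 x * (‖(w i).2‖ ^ 2 / 2)
      ≤ ((N + 1 : ℕ) : ℝ)⁻¹ * ∑ i, 3 / (Real.pi * r ^ 3) * (‖(w i).2‖ ^ 2 / 2) :=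
        mul_le_mul_of_nonneg_left (Finset.sum_le_sum fun i _ =>
          mul_le_mul_of_nonneg_right (cone_nonneg_le hr _ _).2 (by positivity)) (by positivity)
    _ = 3 / (Real.pi * r ^ 3) * ke w := by
        unfold ke
        rw [← Finset.mul_sum]
        ring

section Curve

variable {γ : ℝ → Phase N} (hγ : Measurable γ) (r : ℝ) (x : T3)
include hγ

/-- Cone moments of a measurable mark along a measurable curve are measurable in time. [folklore] -/
theorem measurable_MpsiC_curve {ψ : V3 → ℝ} (hψ : Measurable ψ) : Measurable fun s : ℝ => MpsiC r (γ s) x ψ := by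
  have h : Measurable (fun p : ℝ × T3 => MpsiC r (γ p.1) p.2 ψ) := measurable_MpsiC_orbit hγ r hψ
  have h2 : Measurable fun s : ℝ => ((s, x) : ℝ × T3) := measurable_id.prodMk measurable_const
  exact (Measurable.comp h h2 :)

/-- The mollified density along a measurable curve is measurable in time. [folklore] -/
theorem measurable_rhoC_curve : Measurable fun s : ℝ => rhoC r (γ s) x := by
  have h : Measurable (fun p : ℝ × T3 => rhoC r (γ p.1) p.2) := measurable_rhoC_orbit hγ r
  have h2 : Measurable fun s : ℝ => ((s, x) : ℝ × T3) := measurable_id.prodMk measurable_const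
  exact (Measurable.comp h h2 :)

/-- The mollified momentum along a measurable curve is measurable in time. [folklore] -/
theorem measurable_momC_curve : Measurable fun s : ℝ => momC r (γ s) x := by
  have h : Measurable (fun p : ℝ × T3 => momC r (γ p.1) p.2) := measurable_momC_orbit hγ r
  have h2 : Measurable fun s : ℝ => ((s, x) : ℝ × T3) := measurable_id.prodMk measurable_const
  exact (Measurable.comp h h2 :)

/-- The mollified kinetic energy along a measurable curve is measurable in time. [folklore] -/
theorem measurable_kinC_curve : Measurable fun s : ℝ => kinC r (γ s) x := by
  have h : Measurable (fun p : ℝ × T3 => kinC r (γ p.1) p.2) := measurable_kinC_orbit hγ r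
  have h2 : Measurable fun s : ℝ => ((s, x) : ℝ × T3) := measurable_id.prodMk measurable_const
  exact (Measurable.comp h h2 :)

end Curve

/-- **Integrability of a tent-weighted bounded measurable profile on `[0, τ]`.** [folklore] -/
theorem integrableOn_tent_mul {r : ℝ} (hr : 0 < r) (t₀ τ : ℝ) {X : ℝ → ℝ} (hX : Measurable X) {B : ℝ}
    (hB : ∀ s, |X s| ≤ B) :
    IntegrableOn (fun s => (r ^ 2)⁻¹ * max (1 - |s - t₀| / r ^ 2) 0 * X s) (Icc 0 τ) volume := by
  have hh : 0 < r ^ 2 := by positivity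
  refine Measure.integrableOn_of_bounded (M := (r ^ 2)⁻¹ * B) (by rw [Real.volume_Icc]; exact ENNReal.ofReal_ne_top)
    (((by fun_prop : Measurable fun s : ℝ => (r ^ 2)⁻¹ * max (1 - |s - t₀| / r ^ 2) 0).mul hX).aestronglyMeasurable)
    (ae_of_all _ fun s => ?_)
  rw [Real.norm_eq_abs, abs_mul, abs_of_nonneg (tent_nonneg_le hh _).1]
  exact mul_le_mul (tent_nonneg_le hh _).2 (hB s) (abs_nonneg _) (by positivity)

/-- A bounded measurable profile is integrable on `[0, τ]`. [folklore] -/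
theorem integrableOn_of_abs_le (τ : ℝ) {X : ℝ → ℝ} (hX : Measurable X) {B : ℝ} (hB : ∀ s, |X s| ≤ B) :
    IntegrableOn X (Icc 0 τ) volume :=
  Measure.integrableOn_of_bounded (M := B) (by rw [Real.volume_Icc]; exact ENNReal.ofReal_ne_top) hX.aestronglyMeasurable
    (ae_of_all _ fun s => by rw [Real.norm_eq_abs]; exact hB s)

/-! ## §2 The weight algebra -/

/-- `w (M − mⱼmₖ/ρ) = wM − (wmⱼ)(wmₖ)/(wρ)` for `w ≥ 0` and `m = 0` where `ρ = 0`. [folklore] -/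
theorem weight_mul_stress_eq {w ρ M mj mk : ℝ} (hw : 0 ≤ w) (h0 : ρ = 0 → mj = 0) :
    w * (M - mj * mk / ρ) = w * M - (w * mj) * (w * mk) / (w * ρ) := by
  rcases hw.eq_or_lt with h | h
  · rw [← h]; simp
  · by_cases hρ : ρ = 0
    · rw [hρ, h0 hρ]; simp
    · field_simp

/-- `Σⱼ (wmⱼ − cⱼ wρ)²/(wρ) = w ‖m − ρc‖²/ρ` for `w ≥ 0`. [folklore] -/
theorem sum_weight_sq_div_eq {w ρ : ℝ} (hw : 0 ≤ w) (m c : V3) :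
    ∑ j : Fin 3, (w * m j - c j * (w * ρ)) ^ 2 / (w * ρ) = w * (‖m - ρ • c‖ ^ 2 / ρ) := by
  have hcomp : ∀ j : Fin 3, (m - ρ • c) j = m j - ρ * c j := fun j => by simp
  rw [norm_sq_eq_sum]
  simp only [hcomp]
  rw [Finset.sum_div, Finset.mul_sum]
  refine Finset.sum_congr rfl fun j _ => ?_
  rcases hw.eq_or_lt with h | h
  · rw [← h]; simp
  · by_cases hρ : ρ = 0
    · rw [hρ]; simp
    · field_simp

/-! ## §3 The main term of one window -/

/-- **THE MAIN TERM OF ONE WINDOW.**  See the module docstring. [folklore] -/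
theorem window_main_le {γ : ℝ → Phase N} (hγ : Measurable γ) {K : ℝ} (hK : ∀ s, ke (γ s) ≤ K)
    {r : ℝ} (hr : 0 < r) (hr2 : r < 1 / 2) {τ t₀ : ℝ} (ht₀ : r ^ 2 ≤ t₀) (ht₀τ : t₀ + r ^ 2 ≤ τ) (x : T3)
    {V : ℝ} (hV : 0 < V) (a : Fin 3 → Fin 3 → ℝ) (htr : ∑ j, a j j = 0) {A : ℝ} (hA : ∀ j k, |a j k| ≤ A) (gw : ℝ) :
    |∑ j, ∑ k, gw * a j k * ∫ s in Icc 0 τ, (r ^ 2)⁻¹ * max (1 - |s - t₀| / r ^ 2) 0 *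
        (MpsiC r (γ s) x (fun v => v j * v k) - momC r (γ s) x j * momC r (γ s) x k / rhoC r (γ s) x)| ≤
      |gw| * (A * ∑ j, ∑ k, |((∫ s in Icc 0 τ, (r ^ 2)⁻¹ * max (1 - |s - t₀| / r ^ 2) 0 * MpsiC r (γ s) x (fun v => v j * v k)) -
            (∫ s in Icc 0 τ, (r ^ 2)⁻¹ * max (1 - |s - t₀| / r ^ 2) 0 * MpsiC r (γ s) x (fun v => v j)) *
            (∫ s in Icc 0 τ, (r ^ 2)⁻¹ * max (1 - |s - t₀| / r ^ 2) 0 * MpsiC r (γ s) x (fun v => v k)) /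
            (∫ s in Icc 0 τ, (r ^ 2)⁻¹ * max (1 - |s - t₀| / r ^ 2) 0 * rhoC r (γ s) x)) -
          if j = k then (∑ l, ((∫ s in Icc 0 τ, (r ^ 2)⁻¹ * max (1 - |s - t₀| / r ^ 2) 0 * MpsiC r (γ s) x (fun v => v l * v l)) -
            (∫ s in Icc 0 τ, (r ^ 2)⁻¹ * max (1 - |s - t₀| / r ^ 2) 0 * MpsiC r (γ s) x (fun v => v l)) *
            (∫ s in Icc 0 τ, (r ^ 2)⁻¹ * max (1 - |s - t₀| / r ^ 2) 0 * MpsiC r (γ s) x (fun v => v l)) /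
            (∫ s in Icc 0 τ, (r ^ 2)⁻¹ * max (1 - |s - t₀| / r ^ 2) 0 * rhoC r (γ s) x))) / 3 else 0| +
        3 * A * (4 * V * (∫ s in Icc 0 τ, (r ^ 2)⁻¹ * max (1 - |s - t₀| / r ^ 2) 0 * ‖momC r (γ s) x - momC r (γ t₀) x‖) +
          4 * V ^ 2 * (∫ s in Icc 0 τ, (r ^ 2)⁻¹ * max (1 - |s - t₀| / r ^ 2) 0 * |rhoC r (γ s) x - rhoC r (γ t₀) x|) +
          6 * (∫ s in Icc 0 τ, (r ^ 2)⁻¹ * max (1 - |s - t₀| / r ^ 2) 0 * MpsiC r (γ s) x (sqTail V)) +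
          4 * MpsiC r (γ t₀) x (sqTail V))) := by
  have hh : 0 < r ^ 2 := by positivity
  set w : ℝ → ℝ := fun s => (r ^ 2)⁻¹ * max (1 - |s - t₀| / r ^ 2) 0 with hwdef
  have hw0 : ∀ s, 0 ≤ w s := fun s => (tent_nonneg_le hh _).1
  -- the profiles
  set ρ : ℝ → ℝ := fun s => rhoC r (γ s) x with hρdef
  set m : Fin 3 → ℝ → ℝ := fun j s => MpsiC r (γ s) x (fun v => v j) with hmdef
  set M : Fin 3 → Fin 3 → ℝ → ℝ := fun j k s => MpsiC r (γ s) x (fun v => v j * v k) with hMdef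
  set T : ℝ → ℝ := fun s => MpsiC r (γ s) x (sqTail V) with hTdef
  have hmom : ∀ s j, momC r (γ s) x j = m j s := fun s j => momC_apply_eq_MpsiC r _ x j
  have hm0 : ∀ j s, ρ s = 0 → m j s = 0 := fun j s h => by
    rw [← hmom, momC_eq_zero_of_rhoC hr h]; simp
  -- measurability and bounds
  have hC : 0 ≤ 3 / (Real.pi * r ^ 3) := by positivity
  have hρm : Measurable ρ := measurable_rhoC_curve hγ r x
  have hmm : ∀ j, Measurable (m j) := fun j => measurable_MpsiC_curve hγ r x (by fun_prop)
  have hMm : ∀ j k, Measurable (M j k) := fun j k => measurable_MpsiC_curve hγ r x (by fun_prop)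
  have hTm : Measurable T := measurable_MpsiC_curve hγ r x (measurable_sqTail V)
  have hρb : ∀ s, |ρ s| ≤ 3 / (Real.pi * r ^ 3) := fun s => by
    rw [abs_of_nonneg (rhoC_nonneg hr _ _)]; exact rhoC_le hr _ _
  have hmb : ∀ j s, |m j s| ≤ 3 / (Real.pi * r ^ 3) * (1 / 2 + K) := fun j s =>
    (abs_MpsiC_coord_le hr _ x j).trans (mul_le_mul_of_nonneg_left (by linarith [hK s]) hC)
  have hMb : ∀ j k s, |M j k s| ≤ 3 / (Real.pi * r ^ 3) * (2 * K) := fun j k s =>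
    (abs_MpsiC_quad_le hr _ x j k).trans (mul_le_mul_of_nonneg_left (by linarith [hK s]) hC)
  have hTb : ∀ s, |T s| ≤ 3 / (Real.pi * r ^ 3) * (2 * K) := fun s => by
    have h1 := MpsiC_sqTail_le hr (γ s) x V
    rw [abs_of_nonneg h1.1]
    exact h1.2.trans (mul_le_mul_of_nonneg_left (by linarith [hK s]) hC)
  -- the weighted profiles of helper A
  set R : ℝ → ℝ := fun s => w s * ρ s with hRdef
  set Mw : Fin 3 → ℝ → ℝ := fun j s => w s * m j s with hMwdef
  set Ew : Fin 3 → Fin 3 → ℝ → ℝ := fun j k s => w s * M j k s with hEwdef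
  have hR0 : ∀ s, 0 ≤ R s := fun s => mul_nonneg (hw0 s) (rhoC_nonneg hr _ _)
  have hRm0 : ∀ j s, R s = 0 → Mw j s = 0 := by
    intro j s hs
    rcases mul_eq_zero.1 hs with h | h
    · simp only [hMwdef, h, zero_mul]
    · simp only [hMwdef, hm0 j s h, mul_zero]
  set μ : Measure ℝ := volume.restrict (Icc 0 τ) with hμ
  have hRi : Integrable R μ := integrableOn_tent_mul hr t₀ τ hρm hρb
  have hMwi : ∀ j, Integrable (Mw j) μ := fun j => integrableOn_tent_mul hr t₀ τ (hmm j) (hmb j)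
  have hEwi : ∀ j k, Integrable (Ew j k) μ := fun j k => integrableOn_tent_mul hr t₀ τ (hMm j k) (hMb j k)
  -- the quotient profiles `Mw_j Mw_k / R = w m_j m_k / ρ`, bounded by `(r²)⁻¹ (3/(πr³)) 6 · 2K`-type constants
  have hquot_eq : ∀ j k s, Mw j s * Mw k s / R s = w s * (m j s * m k s / ρ s) := by
    intro j k s
    have h1 := weight_mul_stress_eq (M := M j k s) (mj := m j s) (mk := m k s) (hw0 s) (hm0 j s)
    have h2 : w s * (m j s * m k s / ρ s) = w s * M j k s - w s * (M j k s - m j s * m k s / ρ s) := by ring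
    rw [h2, h1]
    simp only [hRdef, hMwdef]
    ring
  have hquot_b : ∀ j k s, |m j s * m k s / ρ s| ≤ 6 * (3 / (Real.pi * r ^ 3) * K) := by
    intro j k s
    rw [← hmom, ← hmom]
    have h1 := sum_abs_mm_div_le hr (γ s) x
    have h2 : |momC r (γ s) x j * momC r (γ s) x k / rhoC r (γ s) x| ≤
        ∑ i : Fin 3, ∑ i' : Fin 3, |momC r (γ s) x i * momC r (γ s) x i' / rhoC r (γ s) x| :=
      (Finset.single_le_sum (f := fun i' => |momC r (γ s) x j * momC r (γ s) x i' / rhoC r (γ s) x|)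
        (fun i' _ => abs_nonneg _) (Finset.mem_univ k)).trans
        (Finset.single_le_sum (f := fun i => ∑ i' : Fin 3, |momC r (γ s) x i * momC r (γ s) x i' / rhoC r (γ s) x|)
          (fun i _ => Finset.sum_nonneg fun i' _ => abs_nonneg _) (Finset.mem_univ j))
    have h3 := (kinC_le_sup hr (γ s) x).2
    calc |momC r (γ s) x j * momC r (γ s) x k / ρ s| ≤ _ := h2
      _ ≤ 6 * kinC r (γ s) x := h1
      _ ≤ 6 * (3 / (Real.pi * r ^ 3) * K) :=
          mul_le_mul_of_nonneg_left (h3.trans (mul_le_mul_of_nonneg_left (hK s) hC)) (by norm_num)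
  have hquot_m : ∀ j k, Measurable fun s => m j s * m k s / ρ s := fun j k => ((hmm j).mul (hmm k)).div hρm
  have hMMi : ∀ j k, Integrable (fun s => Mw j s * Mw k s / R s) μ := by
    intro j k
    have h1 : (fun s => Mw j s * Mw k s / R s) = fun s => w s * (m j s * m k s / ρ s) := funext (hquot_eq j k)
    rw [h1]
    exact integrableOn_tent_mul hr t₀ τ (hquot_m j k) (hquot_b j k)
  -- ### the identity `∫ w P = C − D`
  have hP : ∀ j k, ∫ s in Icc 0 τ, w s * (M j k s - momC r (γ s) x j * momC r (γ s) x k / ρ s) =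
      ((∫ s, Ew j k s ∂μ) - (∫ s, Mw j s ∂μ) * (∫ s, Mw k s ∂μ) / ∫ s, R s ∂μ) -
        ((∫ s, Mw j s * Mw k s / R s ∂μ) - (∫ s, Mw j s ∂μ) * (∫ s, Mw k s ∂μ) / ∫ s, R s ∂μ) := by
    intro j k
    rw [← integral_stress_eq (hEwi j k) (hMMi j k)]
    refine integral_congr_ae (ae_of_all _ fun s => ?_)
    show w s * (M j k s - momC r (γ s) x j * momC r (γ s) x k / ρ s) = Ew j k s - Mw j s * Mw k s / R s
    rw [hmom, hmom]
    exact weight_mul_stress_eq (hw0 s) (hm0 j s)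
  -- ### the fluctuation `D` : PSD, symmetric, trace bound
  set D : Fin 3 → Fin 3 → ℝ := fun j k =>
    (∫ s, Mw j s * Mw k s / R s ∂μ) - (∫ s, Mw j s ∂μ) * (∫ s, Mw k s ∂μ) / ∫ s, R s ∂μ with hDdef
  have hDsymm : ∀ j k, D j k = D k j := by
    intro j k
    simp only [hDdef]
    have e1 : (fun s => Mw j s * Mw k s / R s) = fun s => Mw k s * Mw j s / R s := funext fun s => by rw [mul_comm (Mw j s)]
    rw [e1, mul_comm (∫ s, Mw j s ∂μ) (∫ s, Mw k s ∂μ)]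
  have hDpsd : ∀ ξ : Fin 3 → ℝ, 0 ≤ ∑ j, ∑ k, ξ j * ξ k * D j k :=
    quadForm_fluct_nonneg hR0 hRm0 hRi hMwi hMMi
  have hDsum : ∑ j, ∑ k, |D j k| ≤ 3 * ∑ j, D j j := sum_abs_le_three_mul_trace hDsymm hDpsd
  -- the slow centre at `t₀`
  obtain ⟨c, hcV, hc1, -⟩ := exists_slow_centre hr (γ t₀) x hV
  have htrace : ∑ j, D j j ≤ ∫ s, w s * (‖momC r (γ s) x - ρ s • c‖ ^ 2 / ρ s) ∂μ := by
    have h1 : ∀ j, D j j ≤ ∫ s, (Mw j s - c j * R s) ^ 2 / R s ∂μ := fun j =>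
      fluct_diag_le hR0 hRm0 hRi hMwi hMMi j (c j)
    have hint : ∀ j, Integrable (fun s => (Mw j s - c j * R s) ^ 2 / R s) μ := by
      intro j
      have e : (fun s => (Mw j s - c j * R s) ^ 2 / R s) =
          fun s => Mw j s * Mw j s / R s - 2 * c j * Mw j s + c j ^ 2 * R s := by
        funext s
        rw [sq_sub_div_eq (hR0 s) (hRm0 j s), sq]
      rw [e]
      exact ((hMMi j j).sub ((hMwi j).const_mul _)).add (hRi.const_mul _)
    calc ∑ j, D j j ≤ ∑ j, ∫ s, (Mw j s - c j * R s) ^ 2 / R s ∂μ := Finset.sum_le_sum fun j _ => h1 j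
      _ = ∫ s, ∑ j, (Mw j s - c j * R s) ^ 2 / R s ∂μ := (integral_finsetSum _ fun j _ => hint j).symm
      _ = ∫ s, w s * (‖momC r (γ s) x - ρ s • c‖ ^ 2 / ρ s) ∂μ := by
          refine integral_congr_ae (ae_of_all _ fun s => ?_)
          have h2 := sum_weight_sq_div_eq (hw0 s) (momC r (γ s) x) c (ρ := ρ s)
          simp only [hmom] at h2 ⊢
          exact h2
  -- the linearised integrand and its integral
  have hlin : ∀ s, w s * (‖momC r (γ s) x - ρ s • c‖ ^ 2 / ρ s) ≤
      w s * (4 * V * ‖momC r (γ s) x - momC r (γ t₀) x‖ + 4 * V ^ 2 * |ρ s - ρ t₀| + 6 * T s + 4 * T t₀) := by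
    intro s
    refine mul_le_mul_of_nonneg_left ?_ (hw0 s)
    have h1 := norm_sq_sub_div_le hr (γ s) x hV hcV
    have h2 : ‖momC r (γ s) x - ρ s • c‖ ≤ ‖momC r (γ s) x - momC r (γ t₀) x‖ + T t₀ / V + V * |ρ s - ρ t₀| := by
      have e : momC r (γ s) x - ρ s • c = (momC r (γ s) x - momC r (γ t₀) x) + (momC r (γ t₀) x - ρ t₀ • c) +
          (ρ t₀ - ρ s) • c := by
        rw [sub_smul]; abel
      rw [e]
      refine (norm_add₃_le).trans (add_le_add (add_le_add le_rfl hc1) ?_)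
      rw [norm_smul, Real.norm_eq_abs, abs_sub_comm, mul_comm]
      exact mul_le_mul_of_nonneg_right hcV (abs_nonneg _)
    have hT0 : 0 ≤ T t₀ := (MpsiC_sqTail_le hr (γ t₀) x V).1
    have h3 : 4 * V * (T t₀ / V) = 4 * T t₀ := by field_simp
    nlinarith [h1, h2, hV, hT0, h3, abs_nonneg (ρ s - ρ t₀), norm_nonneg (momC r (γ s) x - momC r (γ t₀) x)]
  have hΔm_m : Measurable fun s => ‖momC r (γ s) x - momC r (γ t₀) x‖ :=
    ((measurable_momC_curve hγ r x).sub measurable_const).norm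
  have hΔm_b : ∀ s, |‖momC r (γ s) x - momC r (γ t₀) x‖| ≤ 2 * (3 / (Real.pi * r ^ 3) * (1 / 2 + K)) := by
    intro s
    rw [abs_of_nonneg (norm_nonneg _)]
    refine (norm_sub_le _ _).trans ?_
    have h1 := norm_momC_le hr (γ s) x
    have h2 := norm_momC_le hr (γ t₀) x
    nlinarith [hK s, hK t₀, h1, h2, hC]
  have hΔρ_m : Measurable fun s => |ρ s - ρ t₀| := (hρm.sub measurable_const).abs
  have hΔρ_b : ∀ s, |(|ρ s - ρ t₀|)| ≤ 2 * (3 / (Real.pi * r ^ 3)) := by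
    intro s
    rw [abs_abs]
    refine (abs_sub _ _).trans ?_
    linarith [hρb s, hρb t₀]
  have hIΔm := integrableOn_tent_mul hr t₀ τ hΔm_m hΔm_b
  have hIΔρ := integrableOn_tent_mul hr t₀ τ hΔρ_m hΔρ_b
  have hIT := integrableOn_tent_mul hr t₀ τ hTm hTb
  have hIconst : Integrable (fun s => w s * (4 * T t₀)) μ := ((integrable_tent_sub' hh t₀).mul_const (4 * T t₀)).integrableOn
  have hmass : ∫ s, w s ∂μ = 1 := window_mass_eq_one hh (by linarith) ht₀τ
  have htrace2 : ∑ j, D j j ≤ 4 * V * (∫ s, w s * ‖momC r (γ s) x - momC r (γ t₀) x‖ ∂μ) +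
      4 * V ^ 2 * (∫ s, w s * |ρ s - ρ t₀| ∂μ) + 6 * (∫ s, w s * T s ∂μ) + 4 * T t₀ := by
    have hrhs : Integrable (fun s => w s * (4 * V * ‖momC r (γ s) x - momC r (γ t₀) x‖ + 4 * V ^ 2 * |ρ s - ρ t₀| +
        6 * T s + 4 * T t₀)) μ := by
      have e : (fun s => w s * (4 * V * ‖momC r (γ s) x - momC r (γ t₀) x‖ + 4 * V ^ 2 * |ρ s - ρ t₀| +
          6 * T s + 4 * T t₀)) = fun s => 4 * V * (w s * ‖momC r (γ s) x - momC r (γ t₀) x‖) +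
          4 * V ^ 2 * (w s * |ρ s - ρ t₀|) + 6 * (w s * T s) + w s * (4 * T t₀) := by
        funext s; ring
      rw [e]
      exact (((hIΔm.integrable.const_mul _).add (hIΔρ.integrable.const_mul _)).add (hIT.integrable.const_mul _)).add hIconst
    calc ∑ j, D j j ≤ ∫ s, w s * (‖momC r (γ s) x - ρ s • c‖ ^ 2 / ρ s) ∂μ := htrace
      _ ≤ ∫ s, w s * (4 * V * ‖momC r (γ s) x - momC r (γ t₀) x‖ + 4 * V ^ 2 * |ρ s - ρ t₀| + 6 * T s + 4 * T t₀) ∂μ :=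
          integral_mono_of_nonneg (ae_of_all _ fun s => mul_nonneg (hw0 s) (div_nonneg (sq_nonneg _) (rhoC_nonneg hr _ _)))
            hrhs (ae_of_all _ hlin)
      _ = 4 * V * (∫ s, w s * ‖momC r (γ s) x - momC r (γ t₀) x‖ ∂μ) +
          4 * V ^ 2 * (∫ s, w s * |ρ s - ρ t₀| ∂μ) + 6 * (∫ s, w s * T s ∂μ) + 4 * T t₀ := by
          have e : ∀ s, w s * (4 * V * ‖momC r (γ s) x - momC r (γ t₀) x‖ + 4 * V ^ 2 * |ρ s - ρ t₀| +
              6 * T s + 4 * T t₀) = 4 * V * (w s * ‖momC r (γ s) x - momC r (γ t₀) x‖) +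
              4 * V ^ 2 * (w s * |ρ s - ρ t₀|) + 6 * (w s * T s) + w s * (4 * T t₀) := fun s => by ring
          simp_rw [e]
          rw [integral_add, integral_add, integral_add, integral_const_mul, integral_const_mul, integral_const_mul,
            integral_mul_const, hmass, one_mul]
          · exact hIΔm.integrable.const_mul _
          · exact hIΔρ.integrable.const_mul _
          · exact (hIΔm.integrable.const_mul _).add (hIΔρ.integrable.const_mul _)
          · exact hIT.integrable.const_mul _
          · exact ((hIΔm.integrable.const_mul _).add (hIΔρ.integrable.const_mul _)).add (hIT.integrable.const_mul _)
          · exact hIconst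
  -- ### assemble
  set C : Fin 3 → Fin 3 → ℝ := fun j k => (∫ s, Ew j k s ∂μ) - (∫ s, Mw j s ∂μ) * (∫ s, Mw k s ∂μ) / ∫ s, R s ∂μ with hCdef
  have hsum : ∑ j, ∑ k, gw * a j k * ∫ s in Icc 0 τ, w s * (M j k s - momC r (γ s) x j * momC r (γ s) x k / ρ s) =
      gw * ((∑ j, ∑ k, a j k * C j k) - ∑ j, ∑ k, a j k * D j k) := by
    rw [← Finset.sum_sub_distrib, Finset.mul_sum]
    refine Finset.sum_congr rfl fun j _ => ?_
    rw [← Finset.sum_sub_distrib, Finset.mul_sum]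
    refine Finset.sum_congr rfl fun k _ => ?_
    rw [hP j k]
    simp only [hCdef, hDdef]
    ring
  have hA0 : 0 ≤ A := (abs_nonneg _).trans (hA 0 0)
  have h1 : |∑ j, ∑ k, a j k * C j k| ≤ A * ∑ j, ∑ k, |C j k - if j = k then (∑ l, C l l) / 3 else 0| :=
    abs_traceless_contraction_le htr hA
  have h2 : |∑ j, ∑ k, a j k * D j k| ≤ 3 * A * (4 * V * (∫ s, w s * ‖momC r (γ s) x - momC r (γ t₀) x‖ ∂μ) +
      4 * V ^ 2 * (∫ s, w s * |ρ s - ρ t₀| ∂μ) + 6 * (∫ s, w s * T s ∂μ) + 4 * T t₀) := by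
    calc |∑ j, ∑ k, a j k * D j k| ≤ A * ∑ j, ∑ k, |D j k| := abs_contraction_le hA
      _ ≤ A * (3 * ∑ j, D j j) := mul_le_mul_of_nonneg_left hDsum hA0
      _ ≤ A * (3 * _) := mul_le_mul_of_nonneg_left (mul_le_mul_of_nonneg_left htrace2 (by norm_num)) hA0
      _ = _ := by ring
  rw [hsum, abs_mul]
  exact mul_le_mul_of_nonneg_left ((abs_sub _ _).trans (add_le_add h1 h2)) (abs_nonneg _)

/-! ## §4 Registered sub-goal -/

/-- **Registered sub-goal `stub_stressIsotropyOfWindowCovarianceF` (helper F of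
`stub_stressIsotropyOfWindowCovariance`): the sup bound of the mollified kinetic energy**,
`0 ≤ e_r ≤ (3/(πr³)) ke` — the source of the integrability of every tent-weighted cone moment of the window kit.
[folklore] -/
theorem stub_stressIsotropyOfWindowCovarianceF : ∀ {N : ℕ} {r : ℝ}, 0 < r → ∀ (w : Config (N + 1) (Fin 3) T3) (x : T3), 0 ≤ kinC r w x ∧ kinC r w x ≤ 3 / (Real.pi * r ^ 3) * ke w :=
  fun hr w x => kinC_le_sup hr w x

end Summit.AtomisticToContinuum.HydrodynamicLimit.Theorems.ParityBandClosureWindowToCone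

end
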